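import Literature.Geometry.Lorentzian.KerrSmearedPlateHardy
import HarnessLib

/-!
# The smeared plate Hardy inequality: signs of the edge terms

(family `gr`; continuation of `KerrSmearedPlateHardy.lean` toward the (HardyPlate) step of
Moschidis, arXiv:1509.08489, proof of Lemma 4.5; namespace `Literature.Geometry.Lorentzian.Kerr`)

The edge terms of `Kerr.plateHardy_identity` live on the two graphs bounding the wedge and carry
the factor `Dh(y)[y]`, the derivative of the height along the flat ray through `y`. For the
foliation terminating at null infinity this derivative is nonnegative:

* `Kerr.inner_radiusGradVec_apply_self_nonneg`: `⟨∇r, y⟩ = (r²‖y‖² + a²z²)/(rΣ) ≥ 0`;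
* `Kerr.fderiv_scriHeight_apply_self_nonneg`: `Dh♯_{R₁}(y)[y] ≥ 0`
  (`dh♯ = χ((r − R₁)/R₁) σ♯(r) dr`, `σ♯ > 0` on `r > r₊`);
* `Kerr.plateEdge_top_nonpos`: the top edge term `χ'(T − t − h♯) · (−f ψ̃² Dh♯(y)[y]/‖y‖²)` of
  the plate identity is `≤ 0` pointwise — it can be dropped from the upper bounds (it is the
  favourable term of the leaf Hardy inequality `Kerr.leafHardy_smeared`).

No definitions, no named facts (D-0026).

## References

* G. Moschidis, arXiv:1509.08489, proof of Lemma 4.5 (key `Moschidis2016`).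
* M. Dafermos, I. Rodnianski, Y. Shlapentokh-Rothman, arXiv:1402.7034, §3.3 and p. 51
  (key `DafermosRodnianskiShlapentokhrothman2014`).
-/

noncomputable section

open Bundle Set TopologicalSpace Filter MeasureTheory Metric
open scoped Manifold ContDiff Topology ENNReal RealInnerProductSpace

namespace Literature.Geometry.Lorentzian

namespace Kerr

/-! ### The height `h♯_{R₁}` increases along the rays: the top edge term is nonpositive -/

/-- `⟨∇r, y⟩ = (r²‖y‖² + a² z²)/(r Σ) ≥ 0` for the Kerr–Schild radius on a slice. [folklore] -/
theorem inner_radiusGradVec_apply_self_nonneg {a : ℝ} {y : E3}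
    (hr : 0 < radius a (E4.ofTimeSpace 0 y)) : 0 ≤ radiusGrad a y y := by
  have hS := blSigma_pos hr
  rw [radiusGrad_apply]
  have h : (inner ℝ (radiusGradVec a y) y : ℝ) = ∑ i : Fin 3, radiusGradVec a y i * y i := by
    rw [EuclideanSpace.inner_eq_star_dotProduct]
    simp [dotProduct, mul_comm]
  rw [h, Fin.sum_univ_three, radiusGradVec_apply, radiusGradVec_apply, radiusGradVec_apply]
  simp only [Fin.isValue, Fin.reduceEq, ↓reduceIte, add_zero]
  rw [div_mul_eq_mul_div, div_mul_eq_mul_div, div_mul_eq_mul_div, ← add_div, ← add_div]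
  refine div_nonneg ?_ (mul_pos hr hS).le
  nlinarith [sq_nonneg (y 0), sq_nonneg (y 1), sq_nonneg (y 2), sq_nonneg (radius a (E4.ofTimeSpace 0 y)),
    mul_nonneg (sq_nonneg (radius a (E4.ofTimeSpace 0 y))) (sq_nonneg (y 0)),
    mul_nonneg (sq_nonneg (radius a (E4.ofTimeSpace 0 y))) (sq_nonneg (y 1)),
    mul_nonneg (sq_nonneg (radius a (E4.ofTimeSpace 0 y))) (sq_nonneg (y 2)),
    mul_nonneg (sq_nonneg a) (sq_nonneg (y 2))]

/-- **`Dh♯_{R₁}(y)[y] ≥ 0`**: the height of the foliation terminating at `𝓘⁺` is nondecreasing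
along the flat rays (`dh♯ = χ((r − R₁)/R₁) σ♯(r) dr` with `χ, σ♯ ≥ 0` and `⟨∇r, y⟩ ≥ 0`;
`dh♯ = 0` inside `{r < R₁}`). DRSR arXiv:1402.7034, p. 51. [folklore] -/
theorem fderiv_scriHeight_apply_self_nonneg {M a R₁ : ℝ} (hMa : IsSubextremal M a)
    (hR₁ : 2 * M < R₁) (y : E3) : 0 ≤ fderiv ℝ (scriHeight M a R₁) y y := by
  have hM := hMa.pos
  have hRp : rPlus M a < R₁ := (rPlus_le_two_mul hM.le).trans_lt hR₁
  rcases lt_or_ge (radius a (E4.ofTimeSpace 0 y)) R₁ with hy | hy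
  · rw [fderiv_scriHeight_eq_zero (by linarith) hy]; simp
  · have hyp : rPlus M a < radius a (E4.ofTimeSpace 0 y) := hRp.trans_le hy
    have hr : 0 < radius a (E4.ofTimeSpace 0 y) := hMa.rPlus_pos.trans hyp
    have hσ : ContinuousOn (scriSlope M a) (Ioi (rPlus M a)) := (contDiffOn_scriSlope hMa).continuousOn
    have hd := hasFDerivAt_cutoffHeight (σ := scriSlope M a) (a := a) (R₁ := R₁) hMa.rPlus_pos.le
      hσ hRp hyp
    rw [scriHeight_eq_cutoffHeight, hd.fderiv, _root_.smul_apply, smul_eq_mul]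
    exact mul_nonneg (mul_nonneg (Real.smoothTransition.nonneg _) (scriSlope_pos hMa hyp).le)
      (inner_radiusGradVec_apply_self_nonneg hr)

/-- **The top edge term of the plate identity is nonpositive**: at every `y`,
`χ'(T − t − h♯(y)) · (−(f ψ̃² · Dh♯(y)[y] / ‖y‖²)) ≤ 0`. [folklore] -/
theorem plateEdge_top_nonpos {M a R₁ R' : ℝ} (hMa : IsSubextremal M a) (hR₁ : 2 * M < R₁)
    (ψ : region a (rPlus M a) → ℝ) (t T : ℝ) (y : E3) :
    deriv Real.smoothTransition (T - (t + scriHeight M a R₁ y)) *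
        -((radialTransition R' R' y * Function.extend Subtype.val ψ 0
            (E4.ofTimeSpace (t + scriHeight M a R₁ y) y) ^ 2) *
          fderiv ℝ (scriHeight M a R₁) y y / ‖y‖ ^ 2) ≤ 0 := by
  have h1 : 0 ≤ deriv Real.smoothTransition (T - (t + scriHeight M a R₁ y)) :=
    Real.smoothTransition.monotone.deriv_nonneg
  have h2 : 0 ≤ (radialTransition R' R' y * Function.extend Subtype.val ψ 0
      (E4.ofTimeSpace (t + scriHeight M a R₁ y) y) ^ 2) * fderiv ℝ (scriHeight M a R₁) y y / ‖y‖ ^ 2 :=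
    div_nonneg (mul_nonneg (mul_nonneg (radialTransition_nonneg _ _ _) (sq_nonneg _))
      (fderiv_scriHeight_apply_self_nonneg hMa hR₁ y)) (sq_nonneg _)
  nlinarith

end Kerr

end Literature.Geometry.Lorentzian
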